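import Literature.Probability.RandomPlanarGeometry.SLEBubblesAvoidance
import Literature.Probability.RandomPlanarGeometry.BubbleConfigEvents
import Literature.Probability.RandomPlanarGeometry.LoewnerInverseContinuity
import HarnessLib

/-!
# The set `s_ω` of bubbles-with-times hitting `A` is measurable for EVERY driving sample: discharge of `SLEBubbles.ae_measurableSet_bubbleHitSet`

Proof companion of `Literature.Probability.RandomPlanarGeometry.SLEBubblesAvoidance` ([LSW] Thm. 7.3,
the avoidance formula (7.3)), after

* G. F. Lawler, O. Schramm, W. Werner, *Conformal restriction: the chordal case*, J. Amer. Math.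
  Soc. **16** (2003) 917–955, arXiv:math/0209343 (**[LSW]**), §7.2 (pp. 28–29, proof of (7.3)):
  "`P[{K : g_t⁻¹(K + W_t) ∩ A ≠ ∅} | g_t] = P[{K : (K + W_t) ∩ g_t(A) ≠ ∅} | g_t] = −Sh_t(W_t)/6`
  […] Consequently, on the event `γ[0, ∞) ∩ A = ∅`, `P[Ξ ∩ A = ∅ | γ] = exp(λ ∫₀^∞ Sh_t(W_t)/6 dt)`",
  an application of "the properties of Poisson point processes" (footnote of Rem. 7.2, p. 28: the
  counts `|X ∩ D|` of MEASURABLE sets `D` of bubbles) to the set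
  `s_ω = {(K, t) ∈ Ω_b × [0, ∞) : g_t⁻¹(K + W_t) ∩ A ≠ ∅}` (`bubbleHitSet`), whose measurability
  [LSW] leave implicit and `SLEBubblesAvoidance` isolates as the named fact
  `SLEBubbles.ae_measurableSet_bubbleHitSet` (for a.e. `γ` missing `A`, `s_ω` is measurable).

Here that fact is PROVED (`SLEBubbles.ae_measurableSet_bubbleHitSet_holds`), in a stronger,
deterministic form which needs neither `κ ≤ 8/3`, nor [RS], nor `γ ∩ A = ∅`
(`measurableSet_bubbleHitSet`: for EVERY sample `ω` and every closed `A`, `s_ω` is measurable in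
`Ω_b × [0, ∞)`), from two pieces of the tree:

* `Loewner.continuousAt_loewnerInv_uncurry` (`LoewnerInverseContinuity`): `(t, z) ↦ f_t(z) = g_t⁻¹(z)`
  is jointly continuous on `[0, ∞) × ℍ` for a continuous driving function (Rohde–Schramm 2005,
  proof of Thm. 3.6), hence so is `F(t, z) = f_t(z + W_t)`;
* `BubbleConfig.measurableSet_hit_of_isCompact` (`BubbleConfigEvents`): hitting a compact subset
  of `ℍ` is an event of the avoidance σ-field of `Ω_b` ([LSW] §7.1 with §3 p. 10).

The argument (`BubbleConfig.measurableSet_loewnerHitSet`): with the closed dyadic squares `Q` of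
generation `n` cut at height `1/(m+1)`, `Q' = Q ∩ {Im ≥ 1/(m+1)}` (compact, inside `ℍ`),
`s_ω = ⋃ₘ ⋂ₙ ⋃_Q {K : K ∩ Q' ≠ ∅} × {t : ∃ z ∈ Q', F(t, z) ∈ A}`: a bubble `K ⊆ ℍ` has
`f_t(K + W_t) ∩ A ≠ ∅` iff some `z ∈ K`, of height `≥ 1/(m+1)` for some `m`, has `F(t, z) ∈ A`
(then every dyadic square through `z` qualifies); conversely, if the squares of all generations
qualify for one `m` but no point of `K` is mapped into `A`, the compact set
`cl K ∩ {Im ≥ 1/(m+1)} ⊆ K` (`cl K = K ∪ {0}`) lies, with a `δ`-neighbourhood, in the open set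
`{z ∈ ℍ : F(t, z) ∉ A}`, and a square of mesh `≤ δ` meeting `K ∩ {Im ≥ 1/(m+1)}` contains no `z`
with `F(t, z) ∈ A`. The time factors `{t : ∃ z ∈ Q', F(t, z) ∈ A}` are CLOSED (the tube lemma
`IsCompact.eventually_forall_of_forall_eventually` over the compact `Q'`, `A` closed, `F` jointly
continuous), the `Ω_b`-factors are hitting events of compact subsets of `ℍ`.

Mathlib: `IsCompact.eventually_forall_of_forall_eventually`, `IsCompact.exists_cthickening_subset_open`,
`MeasurableSet.prod`, `IsClosed.measurableSet`.
-/

noncomputable section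

open Set Filter MeasureTheory Metric Bornology
open UpperHalfPlane (upperHalfPlaneSet isOpen_upperHalfPlaneSet)
open scoped NNReal ENNReal Topology
open Literature.Probability.Process (preWienerMeasure)

namespace Literature.Probability.RandomPlanarGeometry

/-! ### The map `F(t, z) = f_t(z + W_t)` is jointly continuous off the real axis -/

namespace Loewner

variable {W : ℝ≥0 → ℝ}

/-- A point of `ℍ` translated by a real number stays in `ℍ` (same height). [folklore] -/
theorem im_add_ofReal_pos {z : ℂ} (hz : 0 < z.im) (x : ℝ) : 0 < (z + (x : ℂ)).im := by
  simpa using hz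

/-- **`(t, z) ↦ f_t(z + W_t)` is jointly continuous on `[0, ∞) × ℍ`** for a continuous driving
function (the jointly continuous `(t, z) ↦ f_t(z)`, `continuousAt_loewnerInv_uncurry`, composed
with the continuous `(t, z) ↦ (t, z + W_t)`, which preserves heights). Rohde–Schramm (2005), proof
of Thm. 3.6 ("`H` is clearly continuous"). [cite: RohdeSchramm2005, Thm 3.6 (proof, p. 898)] -/
theorem continuousAt_loewnerInv_add_driving_uncurry (hW : Continuous W) (t : ℝ≥0) {z : ℂ}
    (hz : 0 < z.im) :
    ContinuousAt (fun p : ℝ≥0 × ℂ ↦ loewnerInv W p.1 (p.2 + W p.1)) (t, z) := by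
  have hfun : (fun p : ℝ≥0 × ℂ ↦ loewnerInv W p.1 (p.2 + W p.1)) =
      (fun q : ℝ≥0 × ℂ ↦ loewnerInv W q.1 q.2) ∘ fun p : ℝ≥0 × ℂ ↦ (p.1, p.2 + (W p.1 : ℂ)) := by
    funext p
    rfl
  rw [hfun]
  have hin : Continuous fun p : ℝ≥0 × ℂ ↦ (p.1, p.2 + (W p.1 : ℂ)) :=
    continuous_fst.prodMk (continuous_snd.add (Complex.continuous_ofReal.comp (hW.comp continuous_fst)))
  exact ContinuousAt.comp (continuousAt_loewnerInv_uncurry hW t (im_add_ofReal_pos hz (W t)))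
    hin.continuousAt

/-- `z ↦ f_t(z + W_t)` is continuous at every point of `ℍ`. [folklore] -/
theorem continuousAt_loewnerInv_add_driving (hW : Continuous W) (t : ℝ≥0) {z : ℂ} (hz : 0 < z.im) :
    ContinuousAt (fun z : ℂ ↦ loewnerInv W t (z + W t)) z := by
  have h : ContinuousAt (loewnerInv W t ∘ fun z : ℂ ↦ z + (W t : ℂ)) z :=
    ContinuousAt.comp (continuousAt_loewnerInv hW t (im_add_ofReal_pos hz (W t)))
      (continuous_add_const (W t : ℂ)).continuousAt
  exact h

/-- For a closed `A`, the points of `ℍ` NOT mapped into `A` by `z ↦ f_t(z + W_t)` form an open set.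
[folklore] -/
theorem isOpen_inter_preimage_loewnerInv_add_driving (hW : Continuous W) (t : ℝ≥0) {A : Set ℂ}
    (hA : IsClosed A) :
    IsOpen (upperHalfPlaneSet ∩ (fun z : ℂ ↦ loewnerInv W t (z + W t)) ⁻¹' Aᶜ) := by
  have hcont : ContinuousOn (fun z : ℂ ↦ loewnerInv W t (z + W t)) upperHalfPlaneSet :=
    fun z hz ↦ (continuousAt_loewnerInv_add_driving hW t hz).continuousWithinAt
  exact hcont.isOpen_inter_preimage isOpen_upperHalfPlaneSet hA.isOpen_compl

/-- **The times at which a compact `Q ⊆ ℍ` is mapped into a closed `A` form a closed set**: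
`{t : ∃ z ∈ Q, f_t(z + W_t) ∈ A}` is closed in `[0, ∞)` (its complement is open by the tube lemma
over the compact `Q`, `(t, z) ↦ f_t(z + W_t)` being jointly continuous and `Aᶜ` open). [folklore] -/
theorem isClosed_setOf_exists_loewnerInv_add_driving_mem (hW : Continuous W) {A : Set ℂ}
    (hA : IsClosed A) {Q : Set ℂ} (hQ : IsCompact Q) (hQH : Q ⊆ upperHalfPlaneSet) :
    IsClosed {t : ℝ≥0 | ∃ z ∈ Q, loewnerInv W t (z + W t) ∈ A} := by
  rw [← isOpen_compl_iff, isOpen_iff_mem_nhds]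
  intro t ht
  have ht' : ∀ z ∈ Q, loewnerInv W t (z + W t) ∉ A := fun z hz h ↦ ht ⟨z, hz, h⟩
  have key : ∀ᶠ t' in 𝓝 t, ∀ z ∈ Q, loewnerInv W t' (z + W t') ∉ A := by
    refine hQ.eventually_forall_of_forall_eventually
      (P := fun (t' : ℝ≥0) (z : ℂ) ↦ loewnerInv W t' (z + W t') ∉ A) fun z hz ↦ ?_
    exact (continuousAt_loewnerInv_add_driving_uncurry hW t (hQH hz)).preimage_mem_nhds
      (hA.isOpen_compl.mem_nhds (ht' z hz))
  filter_upwards [key] with t' h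
  rintro ⟨z, hz, hzA⟩
  exact h z hz hzA

end Loewner

/-! ### `{(K, t) : f_t(K + W_t) ∩ A ≠ ∅}` is measurable in `Ω_b × [0, ∞)` -/

/-- Hitting through a map: `f(K) ∩ A ≠ ∅` iff some `z ∈ K` has `f(z) ∈ A`. [folklore] -/
theorem not_disjoint_image_iff_exists {α β : Type*} (f : α → β) (K : Set α) (A : Set β) :
    ¬ Disjoint (f '' K) A ↔ ∃ z ∈ K, f z ∈ A := by
  rw [Set.not_disjoint_iff]
  constructor
  · rintro ⟨_, ⟨z, hz, rfl⟩, hzA⟩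
    exact ⟨z, hz, hzA⟩
  · rintro ⟨z, hz, hzA⟩
    exact ⟨_, ⟨z, hz, rfl⟩, hzA⟩

/-- A mesh finer than any `δ > 0`: some generation `n` has `2/2ⁿ ≤ δ`. [folklore] -/
theorem exists_two_div_two_pow_le {δ : ℝ} (hδ : 0 < δ) : ∃ n : ℕ, (2 : ℝ) / 2 ^ n ≤ δ := by
  obtain ⟨n, hn⟩ := exists_nat_gt (2 / δ)
  refine ⟨n, ?_⟩
  have h2n : (n : ℝ) < 2 ^ n := by exact_mod_cast Nat.lt_two_pow_self
  have h2 : (0 : ℝ) < 2 ^ n := by positivity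
  rw [div_le_iff₀ h2]
  rw [div_lt_iff₀ hδ] at hn
  nlinarith

namespace BubbleConfig

/-- The dyadic square of generation `n`, corner `(a, b)/2ⁿ`, cut at height `1/(m+1)`, is a compact
subset of `ℍ`. [folklore] -/
theorem isCompact_dyadicSquare_inter (n : ℕ) (a b : ℤ) (m : ℕ) :
    IsCompact (dyadicSquare n a b ∩ {z : ℂ | 1 / ((m : ℝ) + 1) ≤ z.im}) :=
  (Metric.isCompact_of_isClosed_isBounded isClosed_dyadicSquare isBounded_dyadicSquare).inter_right
    (isClosed_le continuous_const Complex.continuous_im)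

/-- The cut dyadic squares lie in `ℍ`. [folklore] -/
theorem dyadicSquare_inter_subset (n : ℕ) (a b : ℤ) (m : ℕ) :
    dyadicSquare n a b ∩ {z : ℂ | 1 / ((m : ℝ) + 1) ≤ z.im} ⊆ upperHalfPlaneSet := fun z hz ↦ by
  have hz2 : 1 / ((m : ℝ) + 1) ≤ z.im := hz.2
  show 0 < z.im
  exact lt_of_lt_of_le Nat.one_div_pos_of_nat hz2

/-- **For a continuous driving function `W` and a closed `A`, the set
`{(K, t) ∈ Ω_b × [0, ∞) : f_t(K + W_t) ∩ A ≠ ∅}` is measurable** (product of the avoidance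
σ-field and the Borel σ-field): it equals
`⋃ₘ ⋂ₙ ⋃_{(a,b)} {K : K ∩ Q'ₙₐᵦₘ ≠ ∅} × {t : ∃ z ∈ Q'ₙₐᵦₘ, f_t(z + W_t) ∈ A}` with
`Q'ₙₐᵦₘ = (dyadic square) ∩ {Im ≥ 1/(m+1)}` compact in `ℍ` — hitting events of compact subsets
of `ℍ` (`measurableSet_hit_of_isCompact`) times closed sets of times
(`Loewner.isClosed_setOf_exists_loewnerInv_add_driving_mem`). `⊆`: a point `z ∈ K` mapped into
`A` lies above `1/(m+1)` for some `m` and in a square of every generation. `⊇`: if no point of `K`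
is mapped into `A`, the compact set `cl K ∩ {Im ≥ 1/(m+1)} ⊆ K` has a `δ`-neighbourhood inside the
open set `{z ∈ ℍ : f_t(z + W_t) ∉ A}`, so no square of mesh `≤ δ` meeting `K ∩ {Im ≥ 1/(m+1)}`
contains a point mapped into `A`. This is the measurability of the set
`{(K, t) : g_t⁻¹(K + W_t) ∩ A ≠ ∅}` of [LSW] §7.2 (pp. 28–29), left implicit there.
[cite: LawlerSchrammWerner2003Restriction, §7.2 (pp. 28–29, proof of (7.3)) with the footnote of Rem. 7.2 (p. 28)] -/
theorem measurableSet_loewnerHitSet {W : ℝ≥0 → ℝ} (hW : Continuous W) {A : Set ℂ} (hA : IsClosed A) :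
    MeasurableSet {q : BubbleConfig × ℝ≥0 |
      ¬ Disjoint (Loewner.loewnerInv W q.2 '' ((fun z : ℂ ↦ z + W q.2) '' (q.1 : Set ℂ))) A} := by
  have hrep : {q : BubbleConfig × ℝ≥0 |
      ¬ Disjoint (Loewner.loewnerInv W q.2 '' ((fun z : ℂ ↦ z + W q.2) '' (q.1 : Set ℂ))) A} =
      ⋃ m : ℕ, ⋂ n : ℕ, ⋃ ab : ℤ × ℤ,
        hit (dyadicSquare n ab.1 ab.2 ∩ {z : ℂ | 1 / ((m : ℝ) + 1) ≤ z.im}) ×ˢ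
          {t : ℝ≥0 | ∃ z ∈ dyadicSquare n ab.1 ab.2 ∩ {z : ℂ | 1 / ((m : ℝ) + 1) ≤ z.im},
            Loewner.loewnerInv W t (z + W t) ∈ A} := by
    ext ⟨K, t⟩
    simp only [mem_setOf_eq, mem_iUnion, mem_iInter, mem_prod, mem_hit, image_image,
      not_disjoint_image_iff_exists]
    constructor
    · -- `⊆`: the squares through a point of `K` mapped into `A`
      rintro ⟨z, hzK, hzA⟩
      have hzim : 0 < z.im := K.subset_upperHalfPlaneSet hzK
      obtain ⟨m, hm⟩ := exists_nat_one_div_lt hzim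
      refine ⟨m, fun n ↦ ⟨(⌊(2 : ℝ) ^ n * z.re⌋, ⌊(2 : ℝ) ^ n * z.im⌋), ?_, ?_⟩⟩
      · exact Set.not_disjoint_iff.2 ⟨z, hzK, mem_dyadicSquare_floor z n, hm.le⟩
      · exact ⟨z, ⟨mem_dyadicSquare_floor z n, hm.le⟩, hzA⟩
    · -- `⊇`: by compactness of `cl K ∩ {Im ≥ 1/(m+1)} ⊆ K`
      rintro ⟨m, h⟩
      by_contra hcon
      set L : Set ℂ := closure (K : Set ℂ) ∩ {z : ℂ | 1 / ((m : ℝ) + 1) ≤ z.im} with hL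
      have hLc : IsCompact L :=
        K.isBounded.isCompact_closure.inter_right (isClosed_le continuous_const Complex.continuous_im)
      have hLK : L ⊆ (K : Set ℂ) := by
        rintro z ⟨hzcl, hzim⟩
        have hzim' : 1 / ((m : ℝ) + 1) ≤ z.im := hzim
        rw [K.closure_eq] at hzcl
        rcases hzcl with hz | hz
        · exact hz
        · rw [mem_singleton_iff] at hz
          rw [hz, Complex.zero_im] at hzim'
          exact absurd hzim' (not_le.2 Nat.one_div_pos_of_nat)
      set U : Set ℂ := upperHalfPlaneSet ∩ (fun z : ℂ ↦ Loewner.loewnerInv W t (z + W t)) ⁻¹' Aᶜ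
        with hU
      have hUo : IsOpen U := Loewner.isOpen_inter_preimage_loewnerInv_add_driving hW t hA
      have hLU : L ⊆ U := fun z hz ↦
        ⟨K.subset_upperHalfPlaneSet (hLK hz), fun hzA ↦ hcon ⟨z, hLK hz, hzA⟩⟩
      obtain ⟨δ, hδ, hδU⟩ := hLc.exists_cthickening_subset_open hUo hLU
      obtain ⟨n, hn⟩ := exists_two_div_two_pow_le hδ
      obtain ⟨⟨a, b⟩, hhit, z', hz'Q, hz'A⟩ := h n
      obtain ⟨z₀, hz₀K, hz₀Q⟩ := Set.not_disjoint_iff.1 hhit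
      have hz₀L : z₀ ∈ L := ⟨subset_closure hz₀K, hz₀Q.2⟩
      have hz'U : z' ∈ U := hδU (mem_cthickening_of_dist_le z' z₀ δ L hz₀L
        ((dist_le_of_mem_dyadicSquare hz'Q.1 hz₀Q.1).trans hn))
      exact hz'U.2 hz'A
  rw [hrep]
  refine MeasurableSet.iUnion fun m ↦ MeasurableSet.iInter fun n ↦ MeasurableSet.iUnion fun ab ↦
    MeasurableSet.prod ?_ ?_
  · exact measurableSet_hit_of_isCompact (isCompact_dyadicSquare_inter n ab.1 ab.2 m)
      (dyadicSquare_inter_subset n ab.1 ab.2 m)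
  · exact (Loewner.isClosed_setOf_exists_loewnerInv_add_driving_mem hW hA
      (isCompact_dyadicSquare_inter n ab.1 ab.2 m) (dyadicSquare_inter_subset n ab.1 ab.2 m)).measurableSet

end BubbleConfig

/-! ### The discharge -/

/-- **`s_ω` is measurable for EVERY driving sample and every closed `A`**: the set
`bubbleHitSet κ ω A = {(K, t) : g_t⁻¹(K + W_t) ∩ A ≠ ∅}` of [LSW] §7.2 is measurable in
`Ω_b × [0, ∞)`, for every `κ`, every `ω` (every path of `W = √κ B` is continuous,
`continuous_sleDriving`) and every closed `A` (`BubbleConfig.measurableSet_loewnerHitSet`).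
[cite: LawlerSchrammWerner2003Restriction, §7.2 (pp. 28–29, proof of (7.3)) with the footnote of Rem. 7.2 (p. 28)] -/
theorem measurableSet_bubbleHitSet (κ : ℝ≥0) (ω : ℝ≥0 → ℝ) {A : Set ℂ} (hA : IsClosed A) :
    MeasurableSet (bubbleHitSet κ ω A) :=
  BubbleConfig.measurableSet_loewnerHitSet (continuous_sleDriving κ ω) hA

/-- **Discharge of the named fact `SLEBubbles.ae_measurableSet_bubbleHitSet`** ([LSW] §7.2,
pp. 28–29: the measurability of `s_ω = {(K, t) : g_t⁻¹(K + W_t) ∩ A ≠ ∅}` implicit in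
"on the event `γ[0, ∞) ∩ A = ∅`, `P[Ξ ∩ A = ∅ | γ] = exp(λ ∫₀^∞ Sh_t(W_t)/6 dt)`"): for
`0 < κ ≤ 8/3` and `A ∈ 𝒬*`, for a.e. (indeed every) `ω`, `s_ω` is measurable — a `*`-hull being
closed (`measurableSet_bubbleHitSet`).
[cite: LawlerSchrammWerner2003Restriction, §7.2 (pp. 28–29, proof of (7.3)) with the footnote of Rem. 7.2 (p. 28)] -/
theorem SLEBubbles.ae_measurableSet_bubbleHitSet_holds : SLEBubbles.ae_measurableSet_bubbleHitSet := by
  intro κ _ _ _A hA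
  exact ae_of_all _ fun ω _ ↦ measurableSet_bubbleHitSet κ ω hA.isBoundedHull.isClosed

/-- **[LSW] (7.3) from two named facts**: with the measurability of `s_ω` discharged, the
avoidance formula `SLEBubbles.measure_disjoint` follows from the null-measurability of
`{Ξ ∩ A = ∅}` and the Theorem 6.5 fact alone (`SLEBubbles.measure_disjoint_of_leaves`).
[cite: LawlerSchrammWerner2003Restriction, Thm. 7.3 with eq. (7.3) (pp. 28–29)] -/
theorem SLEBubbles.measure_disjoint_of_two_leaves (hE : SLEBubbles.nullMeasurableSet_disjoint)
    (h65 : SLEBubbles.lintegral_poissonAvoidance_eq_rpow) : SLEBubbles.measure_disjoint :=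
  SLEBubbles.measure_disjoint_of_leaves hE SLEBubbles.ae_measurableSet_bubbleHitSet_holds h65

/-- **[LSW] (7.3) from `Ξ(κ) ∈ Ω` (measurable version) and Theorem 6.5**, the measurability of
`s_ω` being discharged (`SLEBubbles.measure_disjoint_of_version`).
[cite: LawlerSchrammWerner2003Restriction, Thm. 7.3 with eq. (7.3) (pp. 28–29)] -/
theorem SLEBubbles.measure_disjoint_of_version' (h₁ : SLEBubbles.exists_measurable_version)
    (h65 : SLEBubbles.lintegral_poissonAvoidance_eq_rpow) : SLEBubbles.measure_disjoint :=
  SLEBubbles.measure_disjoint_of_version h₁ SLEBubbles.ae_measurableSet_bubbleHitSet_holds h65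

end Literature.Probability.RandomPlanarGeometry

end
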